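import Literature.NumberTheory.Automorphic.CoherentLevelCentralizerDatum                 -- ★ p847718∕ED. 2 (m1): `exists_coherent_centralizerDatum_levelNormalised_of_conjInvariant'`
import Literature.NumberTheory.Rogawski1990.SingularLocalRealisation                      -- ★ (LR-s) `exists_isStablyConj_and_isConj_toLocal_of_corresponds_local`
import Literature.NumberTheory.Rogawski1990.SingularStableClassTransfers                   -- ★ `exists_ne_mul_sub_eq_zero_of_isSemisimpleElt_of_not_isRegularElt_cm`
import Literature.NumberTheory.Rogawski1990.AnisotropicUnitarySemisimple                   -- ★ `isSemisimpleElt_of_anisotropic`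
import Literature.NumberTheory.Rogawski1990.SplitSingularRegularity                        -- ★ `not_isRegularElt_of_coe_eq_smul_one`
import Literature.NumberTheory.Rogawski1990.AdelicStableOrbitalEulerDischargeSemisimple    -- ★ `coe_toLocal_toAdelic_eq_map` (+ brings ★ `eventually_forall_integralConj_cmDatum_of_isSemisimpleElt`)
import Literature.NumberTheory.Rogawski1990.AdelicStableConjugacyG                         -- ★ `eventually_toLocal_mem_cmLocalIntegralLevel`
import Literature.NumberTheory.Automorphic.LocalCentralizerUnimodularOfAdelic              -- ★ `isMulRightInvariant_local_centralizer_toLocal_of_anisotropic`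
import Literature.NumberTheory.Automorphic.LocalOrbitalMeasureSemisimple                   -- ★ `isMulRightInvariant_centralizer_of_isConj`
import Literature.NumberTheory.Automorphic.OrbitalMeasureQuotientOfPointSingular           -- ★ `corresponds_local_conj_right` (+ ★ `IsQuotientOf.atPoint_eq_quotientMeasure_of_forall_map_conj_eq`)
import Literature.NumberTheory.Automorphic.OrbitalIntegralCentralTransport                 -- ★ `quotientMeasure_centralizer_univ_mul_eq` (one-point orbit spaces)
import Literature.NumberTheory.Rogawski1990.ArchCentralizerHaarMeasures                    -- ★ `OrbitalMeasureFamily.exists_isQuotientOf` (the Weil-form constructor)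
import Literature.MeasureTheory.Group.InvariantQuotientCompactOpenMass                     -- ★ `quotientMeasure_image_mk_eq_one` (Weil's mass formula on a compact open subgroup)
import Literature.NumberTheory.Rogawski1990.TamagawaSingularMembersFinTFCovol              -- ★ p844690: the letter whose conjuncts (Q-fin) (COH-fin) (C1)-fin (NORM) are produced here VERBATIM
import HarnessLib

/-!
# THE FINITE SINGULAR PARTNERS AND MEMBERS of the letter S1′-fin-TF-COVOL: (Q-fin) ∧ (COH-fin) ∧ (C1)-fin ∧ (NORM) PRODUCED, with the datum exported
(Rogawski (1990), §1.7 p. 6, §4.3 (4.3.1) pp. 43–44, Prop. 10.1.2 (b) p. 153, §14.5 Lemma 14.5.2 (b) pp. 238–239; Kottwitz (1986), Prop. 7.1; Deitmar–Echterhoff (2014), Thm. 1.5.3)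

Topic `NumberTheory/Rogawski1990`; namespace `Literature.NumberTheory.Rogawski1990`.  THEOREMS ONLY (no definition, no instance, no notation, no named fact, no `sorry`).
Cell `pub/hodgecm-mathlib`, crux H413 (`stmt-HodgeConjecture-24833`), line LH5 (closer stub `stub_S1finTFCovol` = ★ `TamagawaSingularMembersFinTFCovolClosed`, p844690), organ
O1 «FIN-MEMBERS» (m2): at every frame of the letter with ANISOTROPIC hermitian `H′` and LEVEL-NORMALISED two-sided local Haar data `νG_v(U(H′)(𝒪_v)) = 1`, there ARE local Weil partners
`tGs v : ∀ γ, Measure Z(γ)` and members `mGs v` satisfying the letter's first four conjuncts TOKEN FOR TOKEN — (Q-fin) `(mGs v).IsQuotientOf ‹guard› (νG v) (tGs v)`, (COH-fin),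
(C1)-fin, (NORM) — together with three EXPORTS for the covolume ∕ κ-block organs: the partners are Haar and inversion invariant on the whole guard, `(mGs v).atPoint x = dνG_v ∕ d(tGs v x)`
at every guard point ON THE NOSE, and `tGs v (γ₀)_v (Z ∩ K_v) = 1` at all but finitely many `v` for every non-regular rational `γ₀`.
Author LH5-p01 (g0), 2026-09-02.  HONEST LABEL: HC_CM is proved only modulo the printed citations until rung 0 closes; this file is measure plumbing over ★ currency and proves no
printed citation — in particular NOT (T′) and NOT the κ-block, which need print's cross-class «compatible measures» (the partners here are level-normalised, coherent only along
`U(H′)(L⁺_v)`-conjugacy).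

THE MATHEMATICS.  The guard of (Q-fin) at `v` is `P_v x := ∃ γ₀ ∈ U(H′)(L⁺) non-regular, (γ₀)_v ↔ x` (★ `Corresponds` = conjugacy in `GL₃(L ⊗ L⁺_v)`, i.e. LOCAL STABLE conjugacy).
(1) `P_v` is conjugation-stable (★ `corresponds_local_conj_right`).  (2) Every `P_v`-point is `U(H′)(L⁺_v)`-CONJUGATE to `δ_v` for a RATIONAL `δ` (★ (LR-s)
`exists_isStablyConj_and_isConj_toLocal_of_corresponds_local`, [Rogawski1990 §3.8, Kottwitz1986 §7]; `γ₀` is semisimple because `H′` is anisotropic, ★ `isSemisimpleElt_of_anisotropic`,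
and then `(γ₀ − a)(γ₀ − b) = 0` with `a ≠ b`, ★ `exists_ne_mul_sub_eq_zero_of_isSemisimpleElt_of_not_isRegularElt_cm`), so (3) its centraliser is UNIMODULAR (★
`isMulRightInvariant_local_centralizer_toLocal_of_anisotropic` ∘ ★ `isMulRightInvariant_centralizer_of_isConj`).  (4) ★ (m1) gives ONE coherent level-normalised datum `tGs v` on
`P_v`, (5) ★ `OrbitalMeasureFamily.exists_isQuotientOf` the Weil family `mGs v = dνG_v ∕ d(tGs v)` = (Q-fin); (COH-fin) is (m1) (ii); at every guard point the member reads
`dνG_v ∕ d(tGs v x)` (★ `IsQuotientOf.atPoint_eq_quotientMeasure_of_forall_map_conj_eq`); (C1)-fin: a rational scalar `ζ•1` is a non-regular guard point, central at `v`, so (m1) (iv)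
gives `tGs v ζ_v (K_v) = 1 = νG_v(K_v)` and Weil's formula on the one-point orbit space (★ `quotientMeasure_centralizer_univ_mul_eq`) gives mass one [Prop. 10.1.2 (b)]; (NORM): off
the finite set where `(γ₀)_v ∉ K_v` (★ `eventually_toLocal_mem_cmLocalIntegralLevel`) or Kottwitz's integral conjugacy fails (★ `eventually_forall_integralConj_cmDatum_of_isSemisimpleElt`),
(m1) (iii) gives `tGs v (γ₀)_v (Z ∩ K_v) = 1` and Weil's mass formula (★ `quotientMeasure_image_mk_eq_one`) gives `(mGs v).atPoint (γ₀)_v (π K_v) = 1` [§4.3 p. 44].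

* `not_isRegularElt_and_corresponds_self` — a non-regular rational `γ₀` is a guard point at every `v`.
* `exists_rational_isConj_toLocal_of_singularGuard` — (2).   * `isMulRightInvariant_centralizer_of_singularGuard` — (3).
* `forall_mul_toLocal_eq_of_coe_eq_smul_one` — `(ζ•1)_v` is central in `U(H′)(L⁺_v)`.
* **`exists_singularFinPartners`** — the head: `∃ mGs tGs, (Q-fin) ∧ (COH-fin) ∧ (C1)-fin ∧ (NORM) ∧ ‹Haar ∧ InvInv on the guard› ∧ ‹atPoint on the nose› ∧ ‹cofinite level mass one›`.
* ED. 2: **`exists_singularFinMembers_of_partners`** — the JUNCTION «members of partners»: (Q-fin) ∧ (C1)-fin ∧ (NORM) ∧ (X2) for the Weil family of ANY partners with (X1)(COH-fin)(LEV)(CEN).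
* ED. 3: **`singularFinMembers_of_isQuotientOf`** — the JUNCTION for GIVEN members: (C1)-fin ∧ (NORM) ∧ (X2) for ANY `(mGs, tGs)` with (Q-fin)(COH-fin)(LEV)(CEN) (a print organ keeps its own `mGs` for (T′) ∕ κ-block); page pins folded (lit4-(21): Prop. 10.1.2 (b) p. 153; §3.8 ∕ Prop. 3.8.1 p. 30).

## References
* [Rogawski1990] J. D. Rogawski, *Automorphic Representations of Unitary Groups in Three Variables*, Ann. of Math. Stud. 123 (1990), §1.7 p. 6; §3.8 Prop. 3.8.1 p. 30;
  §4.3 (4.3.1) pp. 43–44; Prop. 10.1.2 (b) p. 153; §14.5 Lemma 14.5.2 (b) pp. 238–239.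
* [Kottwitz1986] R. E. Kottwitz, *Stable trace formula: elliptic singular terms*, Math. Ann. 275 (1986), Prop. 7.1, §7.3.
* [DeitmarEchterhoff2014] A. Deitmar, S. Echterhoff, *Principles of Harmonic Analysis*, 2nd ed. (2014), Thm. 1.5.3.
-/

set_option autoImplicit false

noncomputable section

open MeasureTheory Measure Set Filter NumberField IsDedekindDomain
open Literature.MeasureTheory.Group
open scoped Matrix MatrixGroups ENNReal

namespace Literature.NumberTheory.Rogawski1990

open Literature.NumberTheory.Automorphic
open Literature.AlgebraicGeometry.ShimuraVarieties (unitaryGroup hermForm)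

section Guard

variable (L : Type) [Field L] [NumberField L] [IsCMField L] (H' : Matrix (Fin 3) (Fin 3) L)

/-- `H′` anisotropic ⟹ `det H′ ≠ 0` (a kernel vector would be isotropic) — local copy of ★ `GodementHeightFloor.det_ne_zero_of_anisotropic` (not imported). [cite: Rogawski1990, §3.8 p. 30] -/
private theorem det_ne_zero_of_anisotropic_aux (hanis : ∀ x : Fin 3 → L, hermForm (cmConjRingHom L) H' x x = 0 → x = 0) : H'.det ≠ 0 := by
  intro hdet
  obtain ⟨v, hv, hHv⟩ := Matrix.exists_mulVec_eq_zero_iff.mpr hdet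
  refine hv (hanis v ?_)
  rw [hermForm, hHv, dotProduct_zero]

/-- **A NON-REGULAR RATIONAL `γ₀` IS A GUARD POINT OF (Q-fin) AT EVERY `v`** (`(γ₀)_v ↔ (γ₀)_v` by reflexivity of ★ `Corresponds`). [cite: Rogawski1990, §14.1 p. 232] -/
theorem not_isRegularElt_and_corresponds_self (v : HeightOneSpectrum (𝓞 ↥(maximalRealSubfield L))) (γ₀ : (UnitaryGroup.cmDatum L 3 H').Rational)
    (hγ₀ : ¬ IsRegularElt (γ₀.val : GL (Fin 3) L)) :
    ∃ γ₁ : (UnitaryGroup.cmDatum L 3 H').Rational, ¬ IsRegularElt (γ₁.val : GL (Fin 3) L) ∧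
      Corresponds (UnitaryGroup.conjLocal L (IsCMField.complexConj L) v) ((UnitaryGroup.adelicForm L 3 H').map (UnitaryGroup.adeleToLocal L v))
        ((UnitaryGroup.adelicForm L 3 H').map (UnitaryGroup.adeleToLocal L v)) ((UnitaryGroup.cmDatum L 3 H').toLocal v ((UnitaryGroup.cmDatum L 3 H').toAdelic γ₁))
        ((UnitaryGroup.cmDatum L 3 H').toLocal v ((UnitaryGroup.cmDatum L 3 H').toAdelic γ₀)) :=
  ⟨γ₀, hγ₀, IsConj.refl _⟩

/-- **THE GUARD IS CONJUGATION-STABLE** (★ `corresponds_local_conj_right`). [cite: Rogawski1990, §3.1 p. 19; §14.1 p. 232] -/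
theorem singularGuard_conj (v : HeightOneSpectrum (𝓞 ↥(maximalRealSubfield L))) (x q : (UnitaryGroup.cmDatum L 3 H').Local v)
    (hx : ∃ γ₀ : (UnitaryGroup.cmDatum L 3 H').Rational, ¬ IsRegularElt (γ₀.val : GL (Fin 3) L) ∧
      Corresponds (UnitaryGroup.conjLocal L (IsCMField.complexConj L) v) ((UnitaryGroup.adelicForm L 3 H').map (UnitaryGroup.adeleToLocal L v))
        ((UnitaryGroup.adelicForm L 3 H').map (UnitaryGroup.adeleToLocal L v)) ((UnitaryGroup.cmDatum L 3 H').toLocal v ((UnitaryGroup.cmDatum L 3 H').toAdelic γ₀)) x) :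
    ∃ γ₀ : (UnitaryGroup.cmDatum L 3 H').Rational, ¬ IsRegularElt (γ₀.val : GL (Fin 3) L) ∧
      Corresponds (UnitaryGroup.conjLocal L (IsCMField.complexConj L) v) ((UnitaryGroup.adelicForm L 3 H').map (UnitaryGroup.adeleToLocal L v))
        ((UnitaryGroup.adelicForm L 3 H').map (UnitaryGroup.adeleToLocal L v)) ((UnitaryGroup.cmDatum L 3 H').toLocal v ((UnitaryGroup.cmDatum L 3 H').toAdelic γ₀)) (q * x * q⁻¹) := by
  obtain ⟨γ₀, hγ₀, hc⟩ := hx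
  exact ⟨γ₀, hγ₀, UnitaryGroup.corresponds_local_conj_right L v hc q⟩

/-- **EVERY GUARD POINT IS `U(H′)(L⁺_v)`-CONJUGATE TO THE LOCAL COMPONENT OF A RATIONAL ELEMENT** (`H′` hermitian anisotropic): `x ↔ (γ₀)_v` with `γ₀` non-regular rational ⟹ `δ_v ∼ x`
for a rational `δ` (★ (LR-s); `γ₀` semisimple by anisotropy, `(γ₀ − a)(γ₀ − b) = 0`, `a ≠ b` by ★ (S-br)). [cite: Rogawski1990, §3.8 Prop. 3.8.1 (a)(d) p. 30] [cite: Kottwitz1986, §7] -/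
theorem exists_rational_isConj_toLocal_of_singularGuard (hherm : (H'.map (cmConjRingHom L))ᵀ = H') (hanis : ∀ x : Fin 3 → L, hermForm (cmConjRingHom L) H' x x = 0 → x = 0)
    (v : HeightOneSpectrum (𝓞 ↥(maximalRealSubfield L))) (x : (UnitaryGroup.cmDatum L 3 H').Local v)
    (hx : ∃ γ₀ : (UnitaryGroup.cmDatum L 3 H').Rational, ¬ IsRegularElt (γ₀.val : GL (Fin 3) L) ∧
      Corresponds (UnitaryGroup.conjLocal L (IsCMField.complexConj L) v) ((UnitaryGroup.adelicForm L 3 H').map (UnitaryGroup.adeleToLocal L v))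
        ((UnitaryGroup.adelicForm L 3 H').map (UnitaryGroup.adeleToLocal L v)) ((UnitaryGroup.cmDatum L 3 H').toLocal v ((UnitaryGroup.cmDatum L 3 H').toAdelic γ₀)) x) :
    ∃ δ : (UnitaryGroup.cmDatum L 3 H').Rational, IsConj ((UnitaryGroup.cmDatum L 3 H').toLocal v ((UnitaryGroup.cmDatum L 3 H').toAdelic δ)) x := by
  obtain ⟨γ₀, hreg, hcorr⟩ := hx
  have hss : IsSemisimpleElt (cmConjRingHom L) H' (γ₀ : unitaryGroup (cmConjRingHom L) H') :=
    isSemisimpleElt_of_anisotropic (cmConjRingHom L) H' hanis _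
  obtain ⟨a, b, hab, -, -, hγab⟩ :=
    exists_ne_mul_sub_eq_zero_of_isSemisimpleElt_of_not_isRegularElt_cm L hherm (det_ne_zero_of_anisotropic_aux L H' hanis) _ hss hreg
  obtain ⟨δ, -, hδ⟩ := exists_isStablyConj_and_isConj_toLocal_of_corresponds_local hherm (det_ne_zero_of_anisotropic_aux L H' hanis) hab hγab v x hcorr
  exact ⟨δ, hδ⟩

/-- **THE CENTRALISER OF EVERY GUARD POINT IS UNIMODULAR**: every Haar measure on `Z(x) ≤ U(H′)(L⁺_v)` is right invariant (`x ∼ δ_v`, ★ unimodularity at rational points of the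
anisotropic group, transported along the conjugation). [cite: Rogawski1990, §4.9 p. 54] [cite: DeitmarEchterhoff2014, Thm. 1.5.3] -/
theorem isMulRightInvariant_centralizer_of_singularGuard (hherm : (H'.map (cmConjRingHom L))ᵀ = H') (hanis : ∀ x : Fin 3 → L, hermForm (cmConjRingHom L) H' x x = 0 → x = 0)
    (v : HeightOneSpectrum (𝓞 ↥(maximalRealSubfield L))) [MeasurableSpace ((UnitaryGroup.cmDatum L 3 H').Local v)] [BorelSpace ((UnitaryGroup.cmDatum L 3 H').Local v)]
    (x : (UnitaryGroup.cmDatum L 3 H').Local v)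
    (hx : ∃ γ₀ : (UnitaryGroup.cmDatum L 3 H').Rational, ¬ IsRegularElt (γ₀.val : GL (Fin 3) L) ∧
      Corresponds (UnitaryGroup.conjLocal L (IsCMField.complexConj L) v) ((UnitaryGroup.adelicForm L 3 H').map (UnitaryGroup.adeleToLocal L v))
        ((UnitaryGroup.adelicForm L 3 H').map (UnitaryGroup.adeleToLocal L v)) ((UnitaryGroup.cmDatum L 3 H').toLocal v ((UnitaryGroup.cmDatum L 3 H').toAdelic γ₀)) x)
    (ρ : Measure (Subgroup.centralizer ({x} : Set ((UnitaryGroup.cmDatum L 3 H').Local v)))) [ρ.IsHaarMeasure] : ρ.IsMulRightInvariant := by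
  obtain ⟨δ, hδ⟩ := exists_rational_isConj_toLocal_of_singularGuard L H' hherm hanis v x hx
  borelize (UnitaryGroup.cmDatum L 3 H').Adelic
  exact isMulRightInvariant_centralizer_of_isConj hδ
    (fun ρ' _ => UnitaryGroup.isMulRightInvariant_local_centralizer_toLocal_of_anisotropic L H' v hanis δ ρ') ρ

omit [NumberField L] [IsCMField L] in
/-- A conjugation-fixed matrix identity: `M (c • 1) = (c • 1) M`. [folklore] -/
private theorem mul_smul_one_eq_smul_one_mul {R : Type*} [CommRing R] {n : Type*} [Fintype n] [DecidableEq n] (M : Matrix n n R) (c : R) :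
    M * (c • (1 : Matrix n n R)) = (c • (1 : Matrix n n R)) * M := by
  rw [Matrix.mul_smul, Matrix.mul_one, Matrix.smul_mul, Matrix.one_mul]

/-- **THE LOCAL COMPONENT OF A RATIONAL SCALAR IS CENTRAL**: if `γ₀ = ζ•1` then `h (γ₀)_v = (γ₀)_v h` for every `h ∈ U(H′)(L⁺_v)` (its matrix is `(ζ ⊗ 1)•1`, ★ `coe_toLocal_toAdelic_eq_map`).
[cite: Rogawski1990, §3.8 p. 30; Prop. 10.1.2 (b) p. 153] -/
theorem forall_mul_toLocal_eq_of_coe_eq_smul_one (v : HeightOneSpectrum (𝓞 ↥(maximalRealSubfield L))) (γ₀ : (UnitaryGroup.cmDatum L 3 H').Rational) {ζ : L}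
    (hζ : (((γ₀.val : GL (Fin 3) L)) : Matrix (Fin 3) (Fin 3) L) = ζ • (1 : Matrix (Fin 3) (Fin 3) L)) :
    ∀ h : (UnitaryGroup.cmDatum L 3 H').Local v,
      h * (UnitaryGroup.cmDatum L 3 H').toLocal v ((UnitaryGroup.cmDatum L 3 H').toAdelic γ₀) = (UnitaryGroup.cmDatum L 3 H').toLocal v ((UnitaryGroup.cmDatum L 3 H').toAdelic γ₀) * h := by
  intro h
  have hγv : ((((UnitaryGroup.cmDatum L 3 H').toLocal v ((UnitaryGroup.cmDatum L 3 H').toAdelic γ₀)).val : GL (Fin 3) (UnitaryGroup.LocalRing L v)).val :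
      Matrix (Fin 3) (Fin 3) (UnitaryGroup.LocalRing L v)) = algebraMap L (UnitaryGroup.LocalRing L v) ζ • (1 : Matrix (Fin 3) (Fin 3) (UnitaryGroup.LocalRing L v)) := by
    rw [coe_toLocal_toAdelic_eq_map]
    rw [hζ, Matrix.map_smul' _ _ _ (map_mul _), Matrix.map_one _ (map_zero _) (map_one _)]
  apply Subtype.ext
  apply Units.ext
  change (h.val : GL (Fin 3) (UnitaryGroup.LocalRing L v)).val * (((UnitaryGroup.cmDatum L 3 H').toLocal v ((UnitaryGroup.cmDatum L 3 H').toAdelic γ₀)).val : GL (Fin 3) (UnitaryGroup.LocalRing L v)).val =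
    (((UnitaryGroup.cmDatum L 3 H').toLocal v ((UnitaryGroup.cmDatum L 3 H').toAdelic γ₀)).val : GL (Fin 3) (UnitaryGroup.LocalRing L v)).val * (h.val : GL (Fin 3) (UnitaryGroup.LocalRing L v)).val
  rw [hγv, mul_smul_one_eq_smul_one_mul]

end Guard

/-! ## The head: the finite singular partners and members -/

section Partners

variable (L : Type) [Field L] [NumberField L] [IsCMField L] (H' : Matrix (Fin 3) (Fin 3) L)
  [∀ v : HeightOneSpectrum (𝓞 ↥(maximalRealSubfield L)), MeasurableSpace ((UnitaryGroup.cmDatum L 3 H').Local v)]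
  [∀ v : HeightOneSpectrum (𝓞 ↥(maximalRealSubfield L)), BorelSpace ((UnitaryGroup.cmDatum L 3 H').Local v)]
  [∀ (v : HeightOneSpectrum (𝓞 ↥(maximalRealSubfield L))) (γ : (UnitaryGroup.cmDatum L 3 H').Local v),
    MeasurableSpace ((UnitaryGroup.cmDatum L 3 H').Local v ⧸ Subgroup.centralizer ({γ} : Set ((UnitaryGroup.cmDatum L 3 H').Local v)))]
  [∀ (v : HeightOneSpectrum (𝓞 ↥(maximalRealSubfield L))) (γ : (UnitaryGroup.cmDatum L 3 H').Local v),
    BorelSpace ((UnitaryGroup.cmDatum L 3 H').Local v ⧸ Subgroup.centralizer ({γ} : Set ((UnitaryGroup.cmDatum L 3 H').Local v)))]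

/-- **THE FINITE SINGULAR PARTNERS AND MEMBERS (organ O1 «FIN-MEMBERS» of the letter S1′-fin-TF-COVOL).**  `H′ ∈ M₃(L)` hermitian ANISOTROPIC, `νG_v` two-sided Haar measures on
`U(H′)(L⁺_v)` with `νG_v(U(H′)(𝒪_v)) = 1` (`hK`).  THEN there are members `mGs v : OrbitalMeasureFamily (U(H′)(L⁺_v))` and partners `tGs v : ∀ γ, Measure Z(γ)` such that, with the guard
`P_v x := ∃ γ₀ ∈ U(H′)(L⁺) non-regular, (γ₀)_v ↔ x`, the conjuncts of ★ `TamagawaSingularMembersFinTFCovol` hold VERBATIM: **(Q-fin)** `(mGs v).IsQuotientOf P_v (νG v) (tGs v)`; **(COH-fin)**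
`(conj q|_{Z(γ₁)})_* (tGs v γ₁) = tGs v (q γ₁ q⁻¹)` on `P_v`; **(C1)-fin** mass one of `(mGs v).atPoint (ζ•1)_v` at every rational scalar class [Prop. 10.1.2 (b)]; **(NORM)** every non-regular
rational `γ₀` is normalised off a finite `S₀` (★ `UnitaryGroup.IsNormalisedOff`) [§4.3 p. 44]; and the EXPORTS: (X1) `tGs v x` is Haar and inversion invariant at every guard point;
(X2) `(mGs v).atPoint x = quotientMeasure Z(x) (tGs v x) (νG v)` at every guard point; (X3) for every non-regular rational `γ₀`, at all but finitely many `v`, `(γ₀)_v ∈ K_v` and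
`tGs v (γ₀)_v (Z((γ₀)_v) ∩ K_v) = 1`.  Construction: ★ (m1) `exists_coherent_centralizerDatum_levelNormalised_of_conjInvariant'` per place on the guard (unimodular by
`isMulRightInvariant_centralizer_of_singularGuard`), then ★ `OrbitalMeasureFamily.exists_isQuotientOf`.
[cite: Rogawski1990, §1.7 p. 6; §4.3 (4.3.1) pp. 43–44; Prop. 10.1.2 (b) p. 153; §14.5 Lemma 14.5.2 (b) pp. 238–239] [cite: Kottwitz1986, Prop. 7.1; §7.3] [cite: DeitmarEchterhoff2014, Thm. 1.5.3] -/
theorem exists_singularFinPartners (hherm : (H'.map (cmConjRingHom L))ᵀ = H') (hanis : ∀ x : Fin 3 → L, hermForm (cmConjRingHom L) H' x x = 0 → x = 0)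
    (νG : ∀ v : HeightOneSpectrum (𝓞 ↥(maximalRealSubfield L)), Measure ((UnitaryGroup.cmDatum L 3 H').Local v))
    [∀ v, (νG v).IsHaarMeasure] [∀ v, (νG v).IsMulRightInvariant]
    (hK : ∀ v : HeightOneSpectrum (𝓞 ↥(maximalRealSubfield L)), νG v (UnitaryGroup.cmLocalIntegralLevel L 3 H' v : Set ((UnitaryGroup.cmDatum L 3 H').Local v)) = 1) :
    ∃ (mGs : ∀ v : HeightOneSpectrum (𝓞 ↥(maximalRealSubfield L)), OrbitalMeasureFamily ((UnitaryGroup.cmDatum L 3 H').Local v))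
      (tGs : ∀ (v : HeightOneSpectrum (𝓞 ↥(maximalRealSubfield L))) (γ : (UnitaryGroup.cmDatum L 3 H').Local v), Measure ↥(Subgroup.centralizer ({γ} : Set ((UnitaryGroup.cmDatum L 3 H').Local v)))),
      -- (Q-fin) VERBATIM
      (∀ v, (mGs v).IsQuotientOf (fun x : (UnitaryGroup.cmDatum L 3 H').Local v => ∃ γ₀ : (UnitaryGroup.cmDatum L 3 H').Rational, ¬ IsRegularElt (γ₀.val : GL (Fin 3) L) ∧
            Corresponds (UnitaryGroup.conjLocal L (IsCMField.complexConj L) v)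
              ((UnitaryGroup.adelicForm L 3 H').map (UnitaryGroup.adeleToLocal L v))
              ((UnitaryGroup.adelicForm L 3 H').map (UnitaryGroup.adeleToLocal L v))
              ((UnitaryGroup.cmDatum L 3 H').toLocal v ((UnitaryGroup.cmDatum L 3 H').toAdelic γ₀)) x) (νG v) (tGs v)) ∧
      -- (COH-fin) VERBATIM
      (∀ (v : HeightOneSpectrum (𝓞 ↥(maximalRealSubfield L))) (γ₁ γ₂ q : (UnitaryGroup.cmDatum L 3 H').Local v) (hq : (MulAut.conj q : (UnitaryGroup.cmDatum L 3 H').Local v ≃* (UnitaryGroup.cmDatum L 3 H').Local v) γ₁ = γ₂),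
        (∃ γ₀ : (UnitaryGroup.cmDatum L 3 H').Rational, ¬ IsRegularElt (γ₀.val : GL (Fin 3) L) ∧
            Corresponds (UnitaryGroup.conjLocal L (IsCMField.complexConj L) v)
              ((UnitaryGroup.adelicForm L 3 H').map (UnitaryGroup.adeleToLocal L v))
              ((UnitaryGroup.adelicForm L 3 H').map (UnitaryGroup.adeleToLocal L v))
              ((UnitaryGroup.cmDatum L 3 H').toLocal v ((UnitaryGroup.cmDatum L 3 H').toAdelic γ₀)) γ₁) →
        Measure.map (subgroupCongrHomeomorph (MulAut.conj q : (UnitaryGroup.cmDatum L 3 H').Local v ≃* (UnitaryGroup.cmDatum L 3 H').Local v) (Subgroup.centralizer ({γ₁} : Set ((UnitaryGroup.cmDatum L 3 H').Local v)))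
          (Subgroup.centralizer ({γ₂} : Set ((UnitaryGroup.cmDatum L 3 H').Local v))) (forall_apply_mem_centralizer_singleton_iff_of_eq (MulAut.conj q : (UnitaryGroup.cmDatum L 3 H').Local v ≃* (UnitaryGroup.cmDatum L 3 H').Local v) hq)
          (continuous_mulAutConj q) (continuous_mulAutConj_symm q)) (tGs v γ₁) = tGs v γ₂) ∧
      -- (C1)-fin VERBATIM
      (∀ c : ConjClasses (UnitaryGroup.cmDatum L 3 H').Rational,
        (∃ ζ : L, (((Quotient.out c).val : GL (Fin 3) L) : Matrix (Fin 3) (Fin 3) L) = ζ • (1 : Matrix (Fin 3) (Fin 3) L)) →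
        ∀ v, (mGs v).atPoint ((UnitaryGroup.cmDatum L 3 H').toLocal v ((UnitaryGroup.cmDatum L 3 H').toAdelic (Quotient.out c))) Set.univ = 1) ∧
      -- (NORM) VERBATIM
      (∀ γ₀ : (UnitaryGroup.cmDatum L 3 H').Rational, ¬ IsRegularElt (γ₀.val : GL (Fin 3) L) →
        ∃ S₀ : Finset (HeightOneSpectrum (𝓞 ↥(maximalRealSubfield L))), UnitaryGroup.IsNormalisedOff L 3 H' mGs ((UnitaryGroup.cmDatum L 3 H').toAdelic γ₀) S₀) ∧
      -- (X1) the partners are Haar and inversion invariant on the whole guard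
      (∀ (v : HeightOneSpectrum (𝓞 ↥(maximalRealSubfield L))) (x : (UnitaryGroup.cmDatum L 3 H').Local v),
        (∃ γ₀ : (UnitaryGroup.cmDatum L 3 H').Rational, ¬ IsRegularElt (γ₀.val : GL (Fin 3) L) ∧
            Corresponds (UnitaryGroup.conjLocal L (IsCMField.complexConj L) v)
              ((UnitaryGroup.adelicForm L 3 H').map (UnitaryGroup.adeleToLocal L v))
              ((UnitaryGroup.adelicForm L 3 H').map (UnitaryGroup.adeleToLocal L v))
              ((UnitaryGroup.cmDatum L 3 H').toLocal v ((UnitaryGroup.cmDatum L 3 H').toAdelic γ₀)) x) →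
        (tGs v x).IsHaarMeasure ∧ (tGs v x).IsInvInvariant) ∧
      -- (X2) the member read at a guard point, on the nose
      (∀ (v : HeightOneSpectrum (𝓞 ↥(maximalRealSubfield L))) (x : (UnitaryGroup.cmDatum L 3 H').Local v),
        (∃ γ₀ : (UnitaryGroup.cmDatum L 3 H').Rational, ¬ IsRegularElt (γ₀.val : GL (Fin 3) L) ∧
            Corresponds (UnitaryGroup.conjLocal L (IsCMField.complexConj L) v)
              ((UnitaryGroup.adelicForm L 3 H').map (UnitaryGroup.adeleToLocal L v))
              ((UnitaryGroup.adelicForm L 3 H').map (UnitaryGroup.adeleToLocal L v))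
              ((UnitaryGroup.cmDatum L 3 H').toLocal v ((UnitaryGroup.cmDatum L 3 H').toAdelic γ₀)) x) →
        ∃ (_ : (tGs v x).IsHaarMeasure) (_ : (tGs v x).IsInvInvariant),
          (mGs v).atPoint x = quotientMeasure (Subgroup.centralizer ({x} : Set ((UnitaryGroup.cmDatum L 3 H').Local v))) (tGs v x) (isClosed_coe_centralizer_singleton x) (νG v)) ∧
      -- (X3) cofinite integrality and level mass one of the partner at every non-regular rational point
      (∀ γ₀ : (UnitaryGroup.cmDatum L 3 H').Rational, ¬ IsRegularElt (γ₀.val : GL (Fin 3) L) →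
        ∀ᶠ v : HeightOneSpectrum (𝓞 ↥(maximalRealSubfield L)) in cofinite,
          (UnitaryGroup.cmDatum L 3 H').toLocal v ((UnitaryGroup.cmDatum L 3 H').toAdelic γ₀) ∈ UnitaryGroup.cmLocalIntegralLevel L 3 H' v ∧
          tGs v ((UnitaryGroup.cmDatum L 3 H').toLocal v ((UnitaryGroup.cmDatum L 3 H').toAdelic γ₀))
            (Subtype.val ⁻¹' (UnitaryGroup.cmLocalIntegralLevel L 3 H' v : Set ((UnitaryGroup.cmDatum L 3 H').Local v))) = 1) := by
  classical
  have hdet : H'.det ≠ 0 := det_ne_zero_of_anisotropic_aux L H' hanis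
  -- (4) the coherent level-normalised datum per place on the guard (★ (m1) ED. 2, with the central clause)
  have hdat := fun v : HeightOneSpectrum (𝓞 ↥(maximalRealSubfield L)) =>
    exists_coherent_centralizerDatum_levelNormalised_of_conjInvariant' (UnitaryGroup.cmLocalIntegralLevel L 3 H' v)
      (UnitaryGroup.isCompact_isOpen_cmLocalIntegralLevel L 3 H' v).2 (UnitaryGroup.isCompact_isOpen_cmLocalIntegralLevel L 3 H' v).1
      (fun x : (UnitaryGroup.cmDatum L 3 H').Local v => ∃ γ₀ : (UnitaryGroup.cmDatum L 3 H').Rational, ¬ IsRegularElt (γ₀.val : GL (Fin 3) L) ∧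
            Corresponds (UnitaryGroup.conjLocal L (IsCMField.complexConj L) v)
              ((UnitaryGroup.adelicForm L 3 H').map (UnitaryGroup.adeleToLocal L v))
              ((UnitaryGroup.adelicForm L 3 H').map (UnitaryGroup.adeleToLocal L v))
              ((UnitaryGroup.cmDatum L 3 H').toLocal v ((UnitaryGroup.cmDatum L 3 H').toAdelic γ₀)) x)
      (fun x hx ρ _ => isMulRightInvariant_centralizer_of_singularGuard L H' hherm hanis v x hx ρ)
  choose tGs htH htcoh htlev htcen using hdat
  -- (5) the Weil family
  have hm := fun v : HeightOneSpectrum (𝓞 ↥(maximalRealSubfield L)) => OrbitalMeasureFamily.exists_isQuotientOf _ (νG v) (tGs v) (htH v)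
  choose mGs hmQ using hm
  -- (X2) the member at a guard point, on the nose (coherence)
  have hat : ∀ (v : HeightOneSpectrum (𝓞 ↥(maximalRealSubfield L))) (x : (UnitaryGroup.cmDatum L 3 H').Local v),
      (∃ γ₀ : (UnitaryGroup.cmDatum L 3 H').Rational, ¬ IsRegularElt (γ₀.val : GL (Fin 3) L) ∧
          Corresponds (UnitaryGroup.conjLocal L (IsCMField.complexConj L) v)
            ((UnitaryGroup.adelicForm L 3 H').map (UnitaryGroup.adeleToLocal L v))
            ((UnitaryGroup.adelicForm L 3 H').map (UnitaryGroup.adeleToLocal L v))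
            ((UnitaryGroup.cmDatum L 3 H').toLocal v ((UnitaryGroup.cmDatum L 3 H').toAdelic γ₀)) x) →
      ∃ (_ : (tGs v x).IsHaarMeasure) (_ : (tGs v x).IsInvInvariant),
        (mGs v).atPoint x = quotientMeasure (Subgroup.centralizer ({x} : Set ((UnitaryGroup.cmDatum L 3 H').Local v))) (tGs v x) (isClosed_coe_centralizer_singleton x) (νG v) :=
    fun v x hx => (hmQ v).atPoint_eq_quotientMeasure_of_forall_map_conj_eq (fun x q h => singularGuard_conj L H' v x q h) (htcoh v) x hx
  -- (X3) cofinite integrality + level mass one at a non-regular rational point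
  have hlev : ∀ γ₀ : (UnitaryGroup.cmDatum L 3 H').Rational, ¬ IsRegularElt (γ₀.val : GL (Fin 3) L) →
      ∀ᶠ v : HeightOneSpectrum (𝓞 ↥(maximalRealSubfield L)) in cofinite,
        (UnitaryGroup.cmDatum L 3 H').toLocal v ((UnitaryGroup.cmDatum L 3 H').toAdelic γ₀) ∈ UnitaryGroup.cmLocalIntegralLevel L 3 H' v ∧
        tGs v ((UnitaryGroup.cmDatum L 3 H').toLocal v ((UnitaryGroup.cmDatum L 3 H').toAdelic γ₀))
          (Subtype.val ⁻¹' (UnitaryGroup.cmLocalIntegralLevel L 3 H' v : Set ((UnitaryGroup.cmDatum L 3 H').Local v))) = 1 := by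
    intro γ₀ hreg
    have hss : IsSemisimpleElt (cmConjRingHom L) H' (γ₀ : unitaryGroup (cmConjRingHom L) H') :=
      isSemisimpleElt_of_anisotropic (cmConjRingHom L) H' hanis _
    filter_upwards [eventually_forall_integralConj_cmDatum_of_isSemisimpleElt L H' hherm hdet γ₀ hss,
      eventually_toLocal_mem_cmLocalIntegralLevel ((UnitaryGroup.cmDatum L 3 H').toAdelic γ₀)] with v hIC hmem
    refine ⟨hmem, htlev v _ (not_isRegularElt_and_corresponds_self L H' v γ₀ hreg) hmem fun g' _ hg'K hconj => hIC g' hg'K ?_⟩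
    exact (MonoidHom.map_isConj (UnitaryGroup.local L (IsCMField.complexConj L) 3 H' v).subtype hconj).symm
  refine ⟨mGs, tGs, hmQ, htcoh, fun c hc v => ?_, fun γ₀ hreg => ?_, htH, hat, hlev⟩
  · -- (C1)-fin: a rational scalar is a central guard point; (m1) (iv) + Weil's formula on the one-point orbit space
    obtain ⟨ζ, hζ⟩ := hc
    set x : (UnitaryGroup.cmDatum L 3 H').Local v := (UnitaryGroup.cmDatum L 3 H').toLocal v ((UnitaryGroup.cmDatum L 3 H').toAdelic (Quotient.out c)) with hxdef
    have hx : ∃ γ₀ : (UnitaryGroup.cmDatum L 3 H').Rational, ¬ IsRegularElt (γ₀.val : GL (Fin 3) L) ∧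
        Corresponds (UnitaryGroup.conjLocal L (IsCMField.complexConj L) v)
          ((UnitaryGroup.adelicForm L 3 H').map (UnitaryGroup.adeleToLocal L v))
          ((UnitaryGroup.adelicForm L 3 H').map (UnitaryGroup.adeleToLocal L v))
          ((UnitaryGroup.cmDatum L 3 H').toLocal v ((UnitaryGroup.cmDatum L 3 H').toAdelic γ₀)) x :=
      not_isRegularElt_and_corresponds_self L H' v (Quotient.out c) (not_isRegularElt_of_coe_eq_smul_one (Quotient.out c) hζ)
    have hcen : ∀ h : (UnitaryGroup.cmDatum L 3 H').Local v, h * x = x * h := forall_mul_toLocal_eq_of_coe_eq_smul_one L H' v (Quotient.out c) hζ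
    obtain ⟨h1, h2, hq⟩ := hat v x hx
    haveI := h1
    haveI := h2
    haveI hZc : IsClosed ((Subgroup.centralizer ({x} : Set ((UnitaryGroup.cmDatum L 3 H').Local v)) : Subgroup _) : Set ((UnitaryGroup.cmDatum L 3 H').Local v)) :=
      isClosed_coe_centralizer_singleton x
    haveI : LocallyCompactSpace (Subgroup.centralizer ({x} : Set ((UnitaryGroup.cmDatum L 3 H').Local v))) := hZc.isClosedEmbedding_subtypeVal.locallyCompactSpace
    rw [hq]
    have hW := quotientMeasure_centralizer_univ_mul_eq (γ := x) (fun g => by rw [hcen g, mul_inv_cancel_right]) hZc (tGs v x) (νG v)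
      (UnitaryGroup.isCompact_isOpen_cmLocalIntegralLevel L 3 H' v).1.measurableSet
    have h1' : tGs v x {h : Subgroup.centralizer ({x} : Set ((UnitaryGroup.cmDatum L 3 H').Local v)) |
        (h : (UnitaryGroup.cmDatum L 3 H').Local v) ∈ (UnitaryGroup.cmLocalIntegralLevel L 3 H' v : Set ((UnitaryGroup.cmDatum L 3 H').Local v))} = 1 :=
      htcen v x hx hcen
    rwa [h1', mul_one, hK v] at hW
  · -- (NORM): off the finite exceptional set of (X3), Weil's mass formula on the compact open `K_v`
    have hev := hlev γ₀ hreg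
    rw [Filter.eventually_cofinite] at hev
    refine ⟨hev.toFinset, fun v hv => ?_⟩
    have hv' := mt hev.mem_toFinset.2 hv
    simp only [Set.mem_setOf_eq, not_not] at hv'
    obtain ⟨hmem, h1⟩ := hv'
    set x : (UnitaryGroup.cmDatum L 3 H').Local v := (UnitaryGroup.cmDatum L 3 H').toLocal v ((UnitaryGroup.cmDatum L 3 H').toAdelic γ₀) with hxdef
    obtain ⟨hH, hI, hq⟩ := hat v x (not_isRegularElt_and_corresponds_self L H' v γ₀ hreg)
    haveI := hH
    haveI := hI
    haveI hZc : IsClosed ((Subgroup.centralizer ({x} : Set ((UnitaryGroup.cmDatum L 3 H').Local v)) : Subgroup _) : Set ((UnitaryGroup.cmDatum L 3 H').Local v)) :=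
      isClosed_coe_centralizer_singleton x
    haveI : LocallyCompactSpace (Subgroup.centralizer ({x} : Set ((UnitaryGroup.cmDatum L 3 H').Local v))) := hZc.isClosedEmbedding_subtypeVal.locallyCompactSpace
    haveI : SecondCountableTopology (Subgroup.centralizer ({x} : Set ((UnitaryGroup.cmDatum L 3 H').Local v))) := TopologicalSpace.Subtype.secondCountableTopology _
    haveI : SigmaCompactSpace (Subgroup.centralizer ({x} : Set ((UnitaryGroup.cmDatum L 3 H').Local v))) := sigmaCompactSpace_of_locallyCompact_secondCountable
    rw [hq]
    exact quotientMeasure_image_mk_eq_one _ (tGs v x) (νG v) (UnitaryGroup.cmLocalIntegralLevel L 3 H' v)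
      (UnitaryGroup.isCompact_isOpen_cmLocalIntegralLevel L 3 H' v).2 (hK v) h1

/-- **ED. 2 — THE JUNCTION «MEMBERS OF PARTNERS»: (Q-fin) ∧ (C1)-fin ∧ (NORM) (+ the on-the-nose reading (X2)) for the Weil family of ANY admissible partners.**  `νG_v` two-sided Haar with
`νG_v(K_v) = 1`; partners `tGs v : ∀ γ, Measure Z(γ)` which are (X1) Haar and inversion invariant at every guard point, (COH-fin) conjugation-coherent on the guard, (LEV) of level mass one
`tGs v (γ₀)_v (Z ∩ K_v) = 1` at all but finitely many `v` for every non-regular rational `γ₀`, and (CEN) of level mass one at EVERY `v` at the rational scalars `ζ•1`.  THEN the Weil family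
`mGs v := dνG_v ∕ d(tGs v)` (★ `OrbitalMeasureFamily.exists_isQuotientOf`) satisfies (Q-fin), (C1)-fin, (NORM) VERBATIM and (X2).  PURPOSE: the letter's covolume conjunct (T′) and κ-block need
print's CROSS-CLASS «compatible» partners [§1.7 p. 6], not the level-normalised ones of `exists_singularFinPartners`; an organ that brings its OWN partners with (X1)(COH-fin)(LEV)(CEN) plugs into
the letter through this junction (no anisotropy or hermitian hypothesis is used here).
[cite: Rogawski1990, §1.7 p. 6; §4.3 (4.3.1) pp. 43–44; Prop. 10.1.2 (b) p. 153; §14.5 Lemma 14.5.2 (b) pp. 238–239] [cite: DeitmarEchterhoff2014, Thm. 1.5.3] -/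
theorem exists_singularFinMembers_of_partners
    (νG : ∀ v : HeightOneSpectrum (𝓞 ↥(maximalRealSubfield L)), Measure ((UnitaryGroup.cmDatum L 3 H').Local v))
    [∀ v, (νG v).IsHaarMeasure] [∀ v, (νG v).IsMulRightInvariant]
    (hK : ∀ v : HeightOneSpectrum (𝓞 ↥(maximalRealSubfield L)), νG v (UnitaryGroup.cmLocalIntegralLevel L 3 H' v : Set ((UnitaryGroup.cmDatum L 3 H').Local v)) = 1)
    (tGs : ∀ (v : HeightOneSpectrum (𝓞 ↥(maximalRealSubfield L))) (γ : (UnitaryGroup.cmDatum L 3 H').Local v), Measure ↥(Subgroup.centralizer ({γ} : Set ((UnitaryGroup.cmDatum L 3 H').Local v))))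
    -- (X1) Haar ∧ inversion invariant on the guard
    (hX1 : ∀ (v : HeightOneSpectrum (𝓞 ↥(maximalRealSubfield L))) (x : (UnitaryGroup.cmDatum L 3 H').Local v),
        (∃ γ₀ : (UnitaryGroup.cmDatum L 3 H').Rational, ¬ IsRegularElt (γ₀.val : GL (Fin 3) L) ∧
            Corresponds (UnitaryGroup.conjLocal L (IsCMField.complexConj L) v)
              ((UnitaryGroup.adelicForm L 3 H').map (UnitaryGroup.adeleToLocal L v))
              ((UnitaryGroup.adelicForm L 3 H').map (UnitaryGroup.adeleToLocal L v))
              ((UnitaryGroup.cmDatum L 3 H').toLocal v ((UnitaryGroup.cmDatum L 3 H').toAdelic γ₀)) x) →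
        (tGs v x).IsHaarMeasure ∧ (tGs v x).IsInvInvariant)
    -- (COH-fin) VERBATIM
    (hcoh : ∀ (v : HeightOneSpectrum (𝓞 ↥(maximalRealSubfield L))) (γ₁ γ₂ q : (UnitaryGroup.cmDatum L 3 H').Local v) (hq : (MulAut.conj q : (UnitaryGroup.cmDatum L 3 H').Local v ≃* (UnitaryGroup.cmDatum L 3 H').Local v) γ₁ = γ₂),
        (∃ γ₀ : (UnitaryGroup.cmDatum L 3 H').Rational, ¬ IsRegularElt (γ₀.val : GL (Fin 3) L) ∧
            Corresponds (UnitaryGroup.conjLocal L (IsCMField.complexConj L) v)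
              ((UnitaryGroup.adelicForm L 3 H').map (UnitaryGroup.adeleToLocal L v))
              ((UnitaryGroup.adelicForm L 3 H').map (UnitaryGroup.adeleToLocal L v))
              ((UnitaryGroup.cmDatum L 3 H').toLocal v ((UnitaryGroup.cmDatum L 3 H').toAdelic γ₀)) γ₁) →
        Measure.map (subgroupCongrHomeomorph (MulAut.conj q : (UnitaryGroup.cmDatum L 3 H').Local v ≃* (UnitaryGroup.cmDatum L 3 H').Local v) (Subgroup.centralizer ({γ₁} : Set ((UnitaryGroup.cmDatum L 3 H').Local v)))
          (Subgroup.centralizer ({γ₂} : Set ((UnitaryGroup.cmDatum L 3 H').Local v))) (forall_apply_mem_centralizer_singleton_iff_of_eq (MulAut.conj q : (UnitaryGroup.cmDatum L 3 H').Local v ≃* (UnitaryGroup.cmDatum L 3 H').Local v) hq)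
          (continuous_mulAutConj q) (continuous_mulAutConj_symm q)) (tGs v γ₁) = tGs v γ₂)
    -- (LEV) cofinite level mass one at every non-regular rational point
    (hlev : ∀ γ₀ : (UnitaryGroup.cmDatum L 3 H').Rational, ¬ IsRegularElt (γ₀.val : GL (Fin 3) L) →
        ∀ᶠ v : HeightOneSpectrum (𝓞 ↥(maximalRealSubfield L)) in cofinite,
          tGs v ((UnitaryGroup.cmDatum L 3 H').toLocal v ((UnitaryGroup.cmDatum L 3 H').toAdelic γ₀))
            (Subtype.val ⁻¹' (UnitaryGroup.cmLocalIntegralLevel L 3 H' v : Set ((UnitaryGroup.cmDatum L 3 H').Local v))) = 1)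
    -- (CEN) level mass one at the rational scalars, at every place
    (hcen : ∀ (γ₀ : (UnitaryGroup.cmDatum L 3 H').Rational) (ζ : L), (((γ₀.val : GL (Fin 3) L)) : Matrix (Fin 3) (Fin 3) L) = ζ • (1 : Matrix (Fin 3) (Fin 3) L) →
        ∀ v : HeightOneSpectrum (𝓞 ↥(maximalRealSubfield L)),
          tGs v ((UnitaryGroup.cmDatum L 3 H').toLocal v ((UnitaryGroup.cmDatum L 3 H').toAdelic γ₀))
            (Subtype.val ⁻¹' (UnitaryGroup.cmLocalIntegralLevel L 3 H' v : Set ((UnitaryGroup.cmDatum L 3 H').Local v))) = 1) :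
    ∃ (mGs : ∀ v : HeightOneSpectrum (𝓞 ↥(maximalRealSubfield L)), OrbitalMeasureFamily ((UnitaryGroup.cmDatum L 3 H').Local v)),
      -- (Q-fin) VERBATIM
      (∀ v, (mGs v).IsQuotientOf (fun x : (UnitaryGroup.cmDatum L 3 H').Local v => ∃ γ₀ : (UnitaryGroup.cmDatum L 3 H').Rational, ¬ IsRegularElt (γ₀.val : GL (Fin 3) L) ∧
            Corresponds (UnitaryGroup.conjLocal L (IsCMField.complexConj L) v)
              ((UnitaryGroup.adelicForm L 3 H').map (UnitaryGroup.adeleToLocal L v))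
              ((UnitaryGroup.adelicForm L 3 H').map (UnitaryGroup.adeleToLocal L v))
              ((UnitaryGroup.cmDatum L 3 H').toLocal v ((UnitaryGroup.cmDatum L 3 H').toAdelic γ₀)) x) (νG v) (tGs v)) ∧
      -- (C1)-fin VERBATIM
      (∀ c : ConjClasses (UnitaryGroup.cmDatum L 3 H').Rational,
        (∃ ζ : L, (((Quotient.out c).val : GL (Fin 3) L) : Matrix (Fin 3) (Fin 3) L) = ζ • (1 : Matrix (Fin 3) (Fin 3) L)) →
        ∀ v, (mGs v).atPoint ((UnitaryGroup.cmDatum L 3 H').toLocal v ((UnitaryGroup.cmDatum L 3 H').toAdelic (Quotient.out c))) Set.univ = 1) ∧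
      -- (NORM) VERBATIM
      (∀ γ₀ : (UnitaryGroup.cmDatum L 3 H').Rational, ¬ IsRegularElt (γ₀.val : GL (Fin 3) L) →
        ∃ S₀ : Finset (HeightOneSpectrum (𝓞 ↥(maximalRealSubfield L))), UnitaryGroup.IsNormalisedOff L 3 H' mGs ((UnitaryGroup.cmDatum L 3 H').toAdelic γ₀) S₀) ∧
      -- (X2) the member read at a guard point, on the nose
      (∀ (v : HeightOneSpectrum (𝓞 ↥(maximalRealSubfield L))) (x : (UnitaryGroup.cmDatum L 3 H').Local v),
        (∃ γ₀ : (UnitaryGroup.cmDatum L 3 H').Rational, ¬ IsRegularElt (γ₀.val : GL (Fin 3) L) ∧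
            Corresponds (UnitaryGroup.conjLocal L (IsCMField.complexConj L) v)
              ((UnitaryGroup.adelicForm L 3 H').map (UnitaryGroup.adeleToLocal L v))
              ((UnitaryGroup.adelicForm L 3 H').map (UnitaryGroup.adeleToLocal L v))
              ((UnitaryGroup.cmDatum L 3 H').toLocal v ((UnitaryGroup.cmDatum L 3 H').toAdelic γ₀)) x) →
        ∃ (_ : (tGs v x).IsHaarMeasure) (_ : (tGs v x).IsInvInvariant),
          (mGs v).atPoint x = quotientMeasure (Subgroup.centralizer ({x} : Set ((UnitaryGroup.cmDatum L 3 H').Local v))) (tGs v x) (isClosed_coe_centralizer_singleton x) (νG v)) := by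
  classical
  -- the Weil family
  have hm := fun v : HeightOneSpectrum (𝓞 ↥(maximalRealSubfield L)) => OrbitalMeasureFamily.exists_isQuotientOf _ (νG v) (tGs v) (hX1 v)
  choose mGs hmQ using hm
  -- (X2) on the nose, by coherence
  have hat : ∀ (v : HeightOneSpectrum (𝓞 ↥(maximalRealSubfield L))) (x : (UnitaryGroup.cmDatum L 3 H').Local v),
      (∃ γ₀ : (UnitaryGroup.cmDatum L 3 H').Rational, ¬ IsRegularElt (γ₀.val : GL (Fin 3) L) ∧
            Corresponds (UnitaryGroup.conjLocal L (IsCMField.complexConj L) v)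
              ((UnitaryGroup.adelicForm L 3 H').map (UnitaryGroup.adeleToLocal L v))
              ((UnitaryGroup.adelicForm L 3 H').map (UnitaryGroup.adeleToLocal L v))
              ((UnitaryGroup.cmDatum L 3 H').toLocal v ((UnitaryGroup.cmDatum L 3 H').toAdelic γ₀)) x) →
      ∃ (_ : (tGs v x).IsHaarMeasure) (_ : (tGs v x).IsInvInvariant),
        (mGs v).atPoint x = quotientMeasure (Subgroup.centralizer ({x} : Set ((UnitaryGroup.cmDatum L 3 H').Local v))) (tGs v x) (isClosed_coe_centralizer_singleton x) (νG v) :=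
    fun v x hx => (hmQ v).atPoint_eq_quotientMeasure_of_forall_map_conj_eq (fun x q h => singularGuard_conj L H' v x q h) (hcoh v) x hx
  refine ⟨mGs, hmQ, fun c hc v => ?_, fun γ₀ hreg => ?_, hat⟩
  · -- (C1)-fin: a rational scalar is a central guard point; (CEN) + Weil's formula on the one-point orbit space
    obtain ⟨ζ, hζ⟩ := hc
    set x : (UnitaryGroup.cmDatum L 3 H').Local v := (UnitaryGroup.cmDatum L 3 H').toLocal v ((UnitaryGroup.cmDatum L 3 H').toAdelic (Quotient.out c)) with hxdef
    have hx : (∃ γ₀ : (UnitaryGroup.cmDatum L 3 H').Rational, ¬ IsRegularElt (γ₀.val : GL (Fin 3) L) ∧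
            Corresponds (UnitaryGroup.conjLocal L (IsCMField.complexConj L) v)
              ((UnitaryGroup.adelicForm L 3 H').map (UnitaryGroup.adeleToLocal L v))
              ((UnitaryGroup.adelicForm L 3 H').map (UnitaryGroup.adeleToLocal L v))
              ((UnitaryGroup.cmDatum L 3 H').toLocal v ((UnitaryGroup.cmDatum L 3 H').toAdelic γ₀)) x) :=
      not_isRegularElt_and_corresponds_self L H' v (Quotient.out c) (not_isRegularElt_of_coe_eq_smul_one (Quotient.out c) hζ)
    have hcomm : ∀ h : (UnitaryGroup.cmDatum L 3 H').Local v, h * x = x * h := forall_mul_toLocal_eq_of_coe_eq_smul_one L H' v (Quotient.out c) hζ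
    obtain ⟨h1, h2, hq⟩ := hat v x hx
    haveI := h1
    haveI := h2
    haveI hZc : IsClosed ((Subgroup.centralizer ({x} : Set ((UnitaryGroup.cmDatum L 3 H').Local v)) : Subgroup _) : Set ((UnitaryGroup.cmDatum L 3 H').Local v)) :=
      isClosed_coe_centralizer_singleton x
    haveI : LocallyCompactSpace (Subgroup.centralizer ({x} : Set ((UnitaryGroup.cmDatum L 3 H').Local v))) := hZc.isClosedEmbedding_subtypeVal.locallyCompactSpace
    rw [hq]
    have hW := quotientMeasure_centralizer_univ_mul_eq (γ := x) (fun g => by rw [hcomm g, mul_inv_cancel_right]) hZc (tGs v x) (νG v)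
      (UnitaryGroup.isCompact_isOpen_cmLocalIntegralLevel L 3 H' v).1.measurableSet
    have h1' : tGs v x {h : Subgroup.centralizer ({x} : Set ((UnitaryGroup.cmDatum L 3 H').Local v)) |
        (h : (UnitaryGroup.cmDatum L 3 H').Local v) ∈ (UnitaryGroup.cmLocalIntegralLevel L 3 H' v : Set ((UnitaryGroup.cmDatum L 3 H').Local v))} = 1 :=
      hcen (Quotient.out c) ζ hζ v
    rwa [h1', mul_one, hK v] at hW
  · -- (NORM): off the finite exceptional set of (LEV), Weil's mass formula on the compact open `K_v`
    have hev := hlev γ₀ hreg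
    rw [Filter.eventually_cofinite] at hev
    refine ⟨hev.toFinset, fun v hv => ?_⟩
    have h1 := mt hev.mem_toFinset.2 hv
    simp only [Set.mem_setOf_eq, not_not] at h1
    set x : (UnitaryGroup.cmDatum L 3 H').Local v := (UnitaryGroup.cmDatum L 3 H').toLocal v ((UnitaryGroup.cmDatum L 3 H').toAdelic γ₀) with hxdef
    obtain ⟨hH, hI, hq⟩ := hat v x (not_isRegularElt_and_corresponds_self L H' v γ₀ hreg)
    haveI := hH
    haveI := hI
    haveI hZc : IsClosed ((Subgroup.centralizer ({x} : Set ((UnitaryGroup.cmDatum L 3 H').Local v)) : Subgroup _) : Set ((UnitaryGroup.cmDatum L 3 H').Local v)) :=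
      isClosed_coe_centralizer_singleton x
    haveI : LocallyCompactSpace (Subgroup.centralizer ({x} : Set ((UnitaryGroup.cmDatum L 3 H').Local v))) := hZc.isClosedEmbedding_subtypeVal.locallyCompactSpace
    haveI : SecondCountableTopology (Subgroup.centralizer ({x} : Set ((UnitaryGroup.cmDatum L 3 H').Local v))) := TopologicalSpace.Subtype.secondCountableTopology _
    haveI : SigmaCompactSpace (Subgroup.centralizer ({x} : Set ((UnitaryGroup.cmDatum L 3 H').Local v))) := sigmaCompactSpace_of_locallyCompact_secondCountable
    rw [hq]
    exact quotientMeasure_image_mk_eq_one _ (tGs v x) (νG v) (UnitaryGroup.cmLocalIntegralLevel L 3 H' v)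
      (UnitaryGroup.isCompact_isOpen_cmLocalIntegralLevel L 3 H' v).2 (hK v) h1

/-- **ED. 3 — THE JUNCTION FOR GIVEN MEMBERS: (C1)-fin ∧ (NORM) ∧ (X2) for ANY pair `(mGs, tGs)` with (Q-fin) ∧ (COH-fin) ∧ (LEV) ∧ (CEN).**  The form a print organ that brings
its own members AND partners plugs in with (its `(T′)[mGs, tGs]` and κ-block`[mGs]` are then kept for the SAME `mGs`): everything the letter's two cheap conjuncts need is the Weil
reading `(mGs v).atPoint x = dνG_v ∕ d(tGs v x)` at the guard points (★ `IsQuotientOf.atPoint_eq_quotientMeasure_of_forall_map_conj_eq`), Weil's formula on the one-point orbit space of a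
rational scalar [Prop. 10.1.2 (b)] and the mass formula on `K_v` [§4.3 p. 44].  No anisotropy ∕ hermitian hypothesis.
[cite: Rogawski1990, §1.7 p. 6; §4.3 (4.3.1) pp. 43–44; Prop. 10.1.2 (b) p. 153; §14.5 Lemma 14.5.2 (b) pp. 238–239] [cite: DeitmarEchterhoff2014, Thm. 1.5.3] -/
theorem singularFinMembers_of_isQuotientOf
    (νG : ∀ v : HeightOneSpectrum (𝓞 ↥(maximalRealSubfield L)), Measure ((UnitaryGroup.cmDatum L 3 H').Local v))
    [∀ v, (νG v).IsHaarMeasure] [∀ v, (νG v).IsMulRightInvariant]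
    (hK : ∀ v : HeightOneSpectrum (𝓞 ↥(maximalRealSubfield L)), νG v (UnitaryGroup.cmLocalIntegralLevel L 3 H' v : Set ((UnitaryGroup.cmDatum L 3 H').Local v)) = 1)
    (mGs : ∀ v : HeightOneSpectrum (𝓞 ↥(maximalRealSubfield L)), OrbitalMeasureFamily ((UnitaryGroup.cmDatum L 3 H').Local v))
    (tGs : ∀ (v : HeightOneSpectrum (𝓞 ↥(maximalRealSubfield L))) (γ : (UnitaryGroup.cmDatum L 3 H').Local v), Measure ↥(Subgroup.centralizer ({γ} : Set ((UnitaryGroup.cmDatum L 3 H').Local v))))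
    -- (Q-fin) VERBATIM
    (hQ : ∀ v, (mGs v).IsQuotientOf (fun x : (UnitaryGroup.cmDatum L 3 H').Local v => ∃ γ₀ : (UnitaryGroup.cmDatum L 3 H').Rational, ¬ IsRegularElt (γ₀.val : GL (Fin 3) L) ∧
            Corresponds (UnitaryGroup.conjLocal L (IsCMField.complexConj L) v)
              ((UnitaryGroup.adelicForm L 3 H').map (UnitaryGroup.adeleToLocal L v))
              ((UnitaryGroup.adelicForm L 3 H').map (UnitaryGroup.adeleToLocal L v))
              ((UnitaryGroup.cmDatum L 3 H').toLocal v ((UnitaryGroup.cmDatum L 3 H').toAdelic γ₀)) x) (νG v) (tGs v))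
    -- (COH-fin) VERBATIM
    (hcoh : ∀ (v : HeightOneSpectrum (𝓞 ↥(maximalRealSubfield L))) (γ₁ γ₂ q : (UnitaryGroup.cmDatum L 3 H').Local v) (hq : (MulAut.conj q : (UnitaryGroup.cmDatum L 3 H').Local v ≃* (UnitaryGroup.cmDatum L 3 H').Local v) γ₁ = γ₂),
        (∃ γ₀ : (UnitaryGroup.cmDatum L 3 H').Rational, ¬ IsRegularElt (γ₀.val : GL (Fin 3) L) ∧
            Corresponds (UnitaryGroup.conjLocal L (IsCMField.complexConj L) v)
              ((UnitaryGroup.adelicForm L 3 H').map (UnitaryGroup.adeleToLocal L v))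
              ((UnitaryGroup.adelicForm L 3 H').map (UnitaryGroup.adeleToLocal L v))
              ((UnitaryGroup.cmDatum L 3 H').toLocal v ((UnitaryGroup.cmDatum L 3 H').toAdelic γ₀)) γ₁) →
        Measure.map (subgroupCongrHomeomorph (MulAut.conj q : (UnitaryGroup.cmDatum L 3 H').Local v ≃* (UnitaryGroup.cmDatum L 3 H').Local v) (Subgroup.centralizer ({γ₁} : Set ((UnitaryGroup.cmDatum L 3 H').Local v)))
          (Subgroup.centralizer ({γ₂} : Set ((UnitaryGroup.cmDatum L 3 H').Local v))) (forall_apply_mem_centralizer_singleton_iff_of_eq (MulAut.conj q : (UnitaryGroup.cmDatum L 3 H').Local v ≃* (UnitaryGroup.cmDatum L 3 H').Local v) hq)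
          (continuous_mulAutConj q) (continuous_mulAutConj_symm q)) (tGs v γ₁) = tGs v γ₂)
    -- (LEV) cofinite level mass one at every non-regular rational point
    (hlev : ∀ γ₀ : (UnitaryGroup.cmDatum L 3 H').Rational, ¬ IsRegularElt (γ₀.val : GL (Fin 3) L) →
        ∀ᶠ v : HeightOneSpectrum (𝓞 ↥(maximalRealSubfield L)) in cofinite,
          tGs v ((UnitaryGroup.cmDatum L 3 H').toLocal v ((UnitaryGroup.cmDatum L 3 H').toAdelic γ₀))
            (Subtype.val ⁻¹' (UnitaryGroup.cmLocalIntegralLevel L 3 H' v : Set ((UnitaryGroup.cmDatum L 3 H').Local v))) = 1)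
    -- (CEN) level mass one at the rational scalars, at every place
    (hcen : ∀ (γ₀ : (UnitaryGroup.cmDatum L 3 H').Rational) (ζ : L), (((γ₀.val : GL (Fin 3) L)) : Matrix (Fin 3) (Fin 3) L) = ζ • (1 : Matrix (Fin 3) (Fin 3) L) →
        ∀ v : HeightOneSpectrum (𝓞 ↥(maximalRealSubfield L)),
          tGs v ((UnitaryGroup.cmDatum L 3 H').toLocal v ((UnitaryGroup.cmDatum L 3 H').toAdelic γ₀))
            (Subtype.val ⁻¹' (UnitaryGroup.cmLocalIntegralLevel L 3 H' v : Set ((UnitaryGroup.cmDatum L 3 H').Local v))) = 1) :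
      -- (C1)-fin VERBATIM
      (∀ c : ConjClasses (UnitaryGroup.cmDatum L 3 H').Rational,
        (∃ ζ : L, (((Quotient.out c).val : GL (Fin 3) L) : Matrix (Fin 3) (Fin 3) L) = ζ • (1 : Matrix (Fin 3) (Fin 3) L)) →
        ∀ v, (mGs v).atPoint ((UnitaryGroup.cmDatum L 3 H').toLocal v ((UnitaryGroup.cmDatum L 3 H').toAdelic (Quotient.out c))) Set.univ = 1) ∧
      -- (NORM) VERBATIM
      (∀ γ₀ : (UnitaryGroup.cmDatum L 3 H').Rational, ¬ IsRegularElt (γ₀.val : GL (Fin 3) L) →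
        ∃ S₀ : Finset (HeightOneSpectrum (𝓞 ↥(maximalRealSubfield L))), UnitaryGroup.IsNormalisedOff L 3 H' mGs ((UnitaryGroup.cmDatum L 3 H').toAdelic γ₀) S₀) ∧
      -- (X2) the member read at a guard point, on the nose
      (∀ (v : HeightOneSpectrum (𝓞 ↥(maximalRealSubfield L))) (x : (UnitaryGroup.cmDatum L 3 H').Local v),
        (∃ γ₀ : (UnitaryGroup.cmDatum L 3 H').Rational, ¬ IsRegularElt (γ₀.val : GL (Fin 3) L) ∧
            Corresponds (UnitaryGroup.conjLocal L (IsCMField.complexConj L) v)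
              ((UnitaryGroup.adelicForm L 3 H').map (UnitaryGroup.adeleToLocal L v))
              ((UnitaryGroup.adelicForm L 3 H').map (UnitaryGroup.adeleToLocal L v))
              ((UnitaryGroup.cmDatum L 3 H').toLocal v ((UnitaryGroup.cmDatum L 3 H').toAdelic γ₀)) x) →
        ∃ (_ : (tGs v x).IsHaarMeasure) (_ : (tGs v x).IsInvInvariant),
          (mGs v).atPoint x = quotientMeasure (Subgroup.centralizer ({x} : Set ((UnitaryGroup.cmDatum L 3 H').Local v))) (tGs v x) (isClosed_coe_centralizer_singleton x) (νG v)) := by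
  classical
  -- (X2) on the nose, by coherence
  have hat : ∀ (v : HeightOneSpectrum (𝓞 ↥(maximalRealSubfield L))) (x : (UnitaryGroup.cmDatum L 3 H').Local v),
      (∃ γ₀ : (UnitaryGroup.cmDatum L 3 H').Rational, ¬ IsRegularElt (γ₀.val : GL (Fin 3) L) ∧
            Corresponds (UnitaryGroup.conjLocal L (IsCMField.complexConj L) v)
              ((UnitaryGroup.adelicForm L 3 H').map (UnitaryGroup.adeleToLocal L v))
              ((UnitaryGroup.adelicForm L 3 H').map (UnitaryGroup.adeleToLocal L v))
              ((UnitaryGroup.cmDatum L 3 H').toLocal v ((UnitaryGroup.cmDatum L 3 H').toAdelic γ₀)) x) →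
      ∃ (_ : (tGs v x).IsHaarMeasure) (_ : (tGs v x).IsInvInvariant),
        (mGs v).atPoint x = quotientMeasure (Subgroup.centralizer ({x} : Set ((UnitaryGroup.cmDatum L 3 H').Local v))) (tGs v x) (isClosed_coe_centralizer_singleton x) (νG v) :=
    fun v x hx => (hQ v).atPoint_eq_quotientMeasure_of_forall_map_conj_eq (fun x q h => singularGuard_conj L H' v x q h) (hcoh v) x hx
  refine ⟨fun c hc v => ?_, fun γ₀ hreg => ?_, hat⟩
  · -- (C1)-fin
    obtain ⟨ζ, hζ⟩ := hc
    set x : (UnitaryGroup.cmDatum L 3 H').Local v := (UnitaryGroup.cmDatum L 3 H').toLocal v ((UnitaryGroup.cmDatum L 3 H').toAdelic (Quotient.out c)) with hxdef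
    have hx : (∃ γ₀ : (UnitaryGroup.cmDatum L 3 H').Rational, ¬ IsRegularElt (γ₀.val : GL (Fin 3) L) ∧
            Corresponds (UnitaryGroup.conjLocal L (IsCMField.complexConj L) v)
              ((UnitaryGroup.adelicForm L 3 H').map (UnitaryGroup.adeleToLocal L v))
              ((UnitaryGroup.adelicForm L 3 H').map (UnitaryGroup.adeleToLocal L v))
              ((UnitaryGroup.cmDatum L 3 H').toLocal v ((UnitaryGroup.cmDatum L 3 H').toAdelic γ₀)) x) :=
      not_isRegularElt_and_corresponds_self L H' v (Quotient.out c) (not_isRegularElt_of_coe_eq_smul_one (Quotient.out c) hζ)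
    have hcomm : ∀ h : (UnitaryGroup.cmDatum L 3 H').Local v, h * x = x * h := forall_mul_toLocal_eq_of_coe_eq_smul_one L H' v (Quotient.out c) hζ
    obtain ⟨h1, h2, hq⟩ := hat v x hx
    haveI := h1
    haveI := h2
    haveI hZc : IsClosed ((Subgroup.centralizer ({x} : Set ((UnitaryGroup.cmDatum L 3 H').Local v)) : Subgroup _) : Set ((UnitaryGroup.cmDatum L 3 H').Local v)) :=
      isClosed_coe_centralizer_singleton x
    haveI : LocallyCompactSpace (Subgroup.centralizer ({x} : Set ((UnitaryGroup.cmDatum L 3 H').Local v))) := hZc.isClosedEmbedding_subtypeVal.locallyCompactSpace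
    rw [hq]
    have hW := quotientMeasure_centralizer_univ_mul_eq (γ := x) (fun g => by rw [hcomm g, mul_inv_cancel_right]) hZc (tGs v x) (νG v)
      (UnitaryGroup.isCompact_isOpen_cmLocalIntegralLevel L 3 H' v).1.measurableSet
    have h1' : tGs v x {h : Subgroup.centralizer ({x} : Set ((UnitaryGroup.cmDatum L 3 H').Local v)) |
        (h : (UnitaryGroup.cmDatum L 3 H').Local v) ∈ (UnitaryGroup.cmLocalIntegralLevel L 3 H' v : Set ((UnitaryGroup.cmDatum L 3 H').Local v))} = 1 :=
      hcen (Quotient.out c) ζ hζ v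
    rwa [h1', mul_one, hK v] at hW
  · -- (NORM)
    have hev := hlev γ₀ hreg
    rw [Filter.eventually_cofinite] at hev
    refine ⟨hev.toFinset, fun v hv => ?_⟩
    have h1 := mt hev.mem_toFinset.2 hv
    simp only [Set.mem_setOf_eq, not_not] at h1
    set x : (UnitaryGroup.cmDatum L 3 H').Local v := (UnitaryGroup.cmDatum L 3 H').toLocal v ((UnitaryGroup.cmDatum L 3 H').toAdelic γ₀) with hxdef
    obtain ⟨hH, hI, hq⟩ := hat v x (not_isRegularElt_and_corresponds_self L H' v γ₀ hreg)
    haveI := hH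
    haveI := hI
    haveI hZc : IsClosed ((Subgroup.centralizer ({x} : Set ((UnitaryGroup.cmDatum L 3 H').Local v)) : Subgroup _) : Set ((UnitaryGroup.cmDatum L 3 H').Local v)) :=
      isClosed_coe_centralizer_singleton x
    haveI : LocallyCompactSpace (Subgroup.centralizer ({x} : Set ((UnitaryGroup.cmDatum L 3 H').Local v))) := hZc.isClosedEmbedding_subtypeVal.locallyCompactSpace
    haveI : SecondCountableTopology (Subgroup.centralizer ({x} : Set ((UnitaryGroup.cmDatum L 3 H').Local v))) := TopologicalSpace.Subtype.secondCountableTopology _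
    haveI : SigmaCompactSpace (Subgroup.centralizer ({x} : Set ((UnitaryGroup.cmDatum L 3 H').Local v))) := sigmaCompactSpace_of_locallyCompact_secondCountable
    rw [hq]
    exact quotientMeasure_image_mk_eq_one _ (tGs v x) (νG v) (UnitaryGroup.cmLocalIntegralLevel L 3 H' v)
      (UnitaryGroup.isCompact_isOpen_cmLocalIntegralLevel L 3 H' v).2 (hK v) h1

end Partners

end Literature.NumberTheory.Rogawski1990

end
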